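import Literature.NumberTheory.NumberFields.RayClassFieldAdicCharacterTwistConstant
import HarnessLib

/-!
# The `v`-adic Artin character on twisted Artin lifts, PINNED BY A GRÖSSENCHARACTER: `κ_𝔪(τ·g_𝔟)·ψ(𝔟)_v = U_τ` EXACTLY
# (no unit ambiguity) when the Artin clauses live below the conductor `𝔣_ψ` (de Shalit 1987, II.1.4–1.5 (iv), II.4.14 (38)–(40); part 6)

Sequel of `RayClassFieldAdicCharacterTwistConstant.lean` ((U): `κ_𝔪(τg)·β_v·ζ_v = U_τ` with a global unit `ζ`).  For the bridge of the
`j = 0` seam of cell `bsd-print-cf2` the sign `ζ = ±1` does NOT cancel (odd weights `m`); it disappears when the generator `β` of the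
ideal `𝔟` is chosen CANONICALLY as the value `ψ(𝔟)` of a map `ψ : Ideal (𝓞 K) → 𝓞 K` with the three printed properties of the
Grössencharacter of a CM curve (de Shalit II.1.4–1.5: (ii) multiplicative on ideals prime to `𝔣ψ`, (iii) `(ψ 𝔞) = 𝔞`, (iv) `ψ((α)) = α` for
`α ≡ 1 (mod 𝔣ψ)`), and the Artin clauses are read at a modulus `𝔐 ⊆ 𝔣ψ·v̄²·v`: then two instances `𝔟`, `𝔟₀` with the same Artin symbol
are ray-equivalent mod `𝔣ψ·v̄²·v`, `(c′)·𝔟 = (b′)·𝔟₀` with `b′ ≡ c′ ≡ 1`, so `c′·ψ(𝔟) = b′·ψ(𝔟₀)` EXACTLY by (ii)+(iv), while on the Galois side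
`κ(g₀⁻¹g) = c′_v·b′_v⁻¹` (the `κ`-calculus of part 5) — whence `κ(τg)·ψ(𝔟)_v = κ(τg₀)·ψ(𝔟₀)_v =: U_τ`.

* §1 ideal-level helpers: `absRestrictNormalHom_eq_artinSymbol_ideal_of_le` (Artin data of an IDEAL restrict down the tower),
  `isCoprime_span_singleton_of_sub_one_mem`, `not_mem_of_span_eq_of_isCoprime` (`ψ(𝔟)` is a `v`-unit);
* §2 ★★ `rayAdicCharacter_inv_mul_mul_integerUnit_eq_of_ideal_eq` — `κ_𝔪(g₀⁻¹g)·β_v = β₀,v` for Artin lifts of IDEALS `𝔟₀`, `𝔟` agreeing on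
  `K(𝔪)`, given elements `b′ ≡ c′ ≡ 1 (mod 𝔪)` outside `v` with `(c′)𝔟 = (b′)𝔟₀` and generators with `c′β = b′β₀`;
* §3 ★★★ `exists_unit_forall_rayAdicCharacter_mul_integerUnit_grossen_eq` — **`∃ U_τ, ∀ levels (𝔪 ⊆ v̄², 𝔐 ⊆ 𝔣ψ·v̄²·v ⊓ 𝔪, 𝔟 prime to 𝔐,
  Artin lift g of 𝔟 on the v-tower over K(𝔪), τ⁻¹|_{K(𝔐)} = (𝔟, K(𝔐)/K)): κ_𝔪(τg)·ψ(𝔟)_v = U_τ`** — the hypothesis (U♯) of the bridge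
  `P1_of_lane` (width seat `bsd-line-cf2-p1-w3` g32), no class-number hypothesis.

Theorems only; no named fact (the three properties of `ψ` are HYPOTHESES, supplied by the fifth print at the call site), no `sorry`.

## References
* [deShalit1987] E. de Shalit, *Iwasawa theory of elliptic curves with complex multiplication* (1987), II.1.4–1.5 (15)–(18) (p. 35–36),
  II.1.7 (p. 41), II.4.12 (p. 66–68), II.4.14 (38)–(40) (p. 71–72).
* [NeukirchANT1999] J. Neukirch, *Algebraic Number Theory* (1999), Ch. VI §1 Def. (1.7), Prop. (1.9), §7 Thm. (7.1).
-/

noncomputable section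

open NumberField IsDedekindDomain IsDedekindDomain.HeightOneSpectrum Field
open scoped nonZeroDivisors Classical

namespace Literature.NumberTheory.NumberFields

open Literature.NumberTheory.GaloisRepresentations Literature.NumberTheory.LFunctions Literature.NumberTheory.LFunctions.AbelianDensity

variable {K : Type} [Field K] [NumberField K]

/-! ### §1. Ideal-level helpers -/

section Helpers

variable {v : HeightOneSpectrum (𝓞 K)}

omit [NumberField K] in
/-- A product avoids the prime `v` when its factors do. [folklore] -/
private theorem mul_not_mem' {α β : 𝓞 K} (hα : α ∉ v.asIdeal) (hβ : β ∉ v.asIdeal) : α * β ∉ v.asIdeal :=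
  fun h => (v.isPrime.mem_or_mem h).elim hα hβ

omit [NumberField K] in
/-- Coprimality survives enlarging the second ideal. [folklore] -/
private theorem isCoprime_of_le' {I J J' : Ideal (𝓞 K)} (h : IsCoprime I J) (hle : J ≤ J') : IsCoprime I J' := by
  rw [Ideal.isCoprime_iff_sup_eq] at h ⊢
  exact top_le_iff.mp (h ▸ sup_le_sup_left hle I)

omit [NumberField K] in
/-- `α ≡ 1 (mod 𝔣)` ⟹ `(α)` is prime to `𝔣`. [cite: NeukirchANT1999, Ch. VI §1 Prop. (1.9)] -/
theorem isCoprime_span_singleton_of_sub_one_mem {𝔣 : Ideal (𝓞 K)} {α : 𝓞 K} (h : α - 1 ∈ 𝔣) :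
    IsCoprime (Ideal.span {α}) 𝔣 := by
  rw [Ideal.isCoprime_iff_exists]
  exact ⟨α, Ideal.mem_span_singleton_self α, -(α - 1), 𝔣.neg_mem h, by ring⟩

omit [NumberField K] in
/-- `α ≡ 1 (mod 𝔣)` with `𝔣 ⊆ v` ⟹ `α ∉ v`. [folklore] -/
private theorem not_mem_of_sub_one_mem_of_le {𝔣 : Ideal (𝓞 K)} {α : 𝓞 K} (h : α - 1 ∈ 𝔣) (hle : 𝔣 ≤ v.asIdeal) : α ∉ v.asIdeal :=
  fun hα => v.isPrime.ne_top ((Ideal.eq_top_iff_one _).mpr (by simpa using v.asIdeal.sub_mem hα (hle h)))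

omit [NumberField K] in
/-- A generator of an ideal prime to `v` avoids `v`: `(β) = 𝔟`, `𝔟 + v = (1)` ⟹ `β ∉ v` (the value `ψ(𝔞)` of the Grössencharacter
at an ideal prime to `𝔭` is a `𝔭`-unit, de Shalit II.1.5 (18)). [cite: deShalit1987, II.1.5 (18) (p. 36)] -/
theorem not_mem_of_span_eq_of_isCoprime {𝔟 : Ideal (𝓞 K)} {β : 𝓞 K} (hspan : Ideal.span {β} = 𝔟) (h : IsCoprime 𝔟 v.asIdeal) :
    β ∉ v.asIdeal := by
  intro hβ
  rw [← hspan, Ideal.isCoprime_iff_sup_eq] at h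
  have : Ideal.span {β} ⊔ v.asIdeal ≤ v.asIdeal := sup_le ((Ideal.span_singleton_le_iff_mem _).mpr hβ) le_rfl
  exact v.isPrime.ne_top (top_le_iff.mp (h ▸ this))

variable [IsTotallyComplex K]

omit [IsTotallyComplex K] in
/-- **Artin data of an IDEAL restrict down the tower**: if `σ|_{K(𝔐')} = (𝔟, K(𝔐')/K)` and `𝔐' ⊆ 𝔐`, then `σ|_{K(𝔐)} = (𝔟, K(𝔐)/K)`
(both restrictions of the universal Artin lift of `𝔟`). [cite: NeukirchANT1999, Ch. VI §7 Thm. (7.1)] -/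
theorem absRestrictNormalHom_eq_artinSymbol_ideal_of_le {𝔐 𝔐' : Ideal (𝓞 K)} (h𝔐' : 𝔐' ≠ ⊥) (h𝔐 : 𝔐 ≠ ⊥) (hle : 𝔐' ≤ 𝔐)
    {𝔟 : Ideal (𝓞 K)} (h𝔟0 : 𝔟 ≠ ⊥) (h𝔟c : IsCoprime 𝔟 𝔐') {σ : absoluteGaloisGroup K}
    (hσ : absRestrictNormalHom (rayClassField K 𝔐') σ = artinSymbol (galFrob K (rayClassField K 𝔐')) 𝔟) :
    absRestrictNormalHom (rayClassField K 𝔐) σ = artinSymbol (galFrob K (rayClassField K 𝔐)) 𝔟 := by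
  obtain ⟨σ₀, hσ₀⟩ := exists_forall_absRestrictNormalHom_eq_artinHom (K := K)
    (Units.mk0 (𝔟 : FractionalIdeal (𝓞 K)⁰ K) (coeIdeal_ne_zero_of_ne_bot h𝔟0))
  have e1 : absRestrictNormalHom (rayClassField K 𝔐') σ = absRestrictNormalHom (rayClassField K 𝔐') σ₀ := by
    rw [hσ, hσ₀ 𝔐' h𝔐' (unitsMk0_coeIdeal_mem_idealsPrimeTo h𝔐' h𝔟0 h𝔟c), artinHom_unitsMk0_coeIdeal _ h𝔟0]
  rw [absRestrictNormalHom_eq_of_le (rayClassField_le_of_le h𝔐' hle) e1,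
    hσ₀ 𝔐 h𝔐 (unitsMk0_coeIdeal_mem_idealsPrimeTo h𝔐 h𝔟0 (isCoprime_of_le' h𝔟c hle)), artinHom_unitsMk0_coeIdeal _ h𝔟0]

end Helpers

/-! ### §2. Two Artin lifts of IDEALS agreeing on `K(𝔪)` with a pinned generator relation: `κ_𝔪(g₀⁻¹g)·β_v = β₀,v` exactly -/

section Key

variable [IsTotallyComplex K] {v : HeightOneSpectrum (𝓞 K)} {𝔪 : Ideal (𝓞 K)}
  (h𝔪 : 𝔪 ≠ ⊥) (hv : ¬ 𝔪 ≤ v.asIdeal) (hw : ∀ u : (𝓞 K)ˣ, (u : 𝓞 K) - 1 ∈ 𝔪 → u = 1)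

/-- ★★ **`κ_𝔪(g₀⁻¹g)·β_v = β₀,v` EXACTLY**: `𝔟₀, 𝔟 ≠ 0` prime to `𝔪v`, Artin lifts `g₀`, `g` of them on every `K(𝔪vⁿ)` agreeing on `K(𝔪)`,
elements `b′ ≡ c′ ≡ 1 (mod 𝔪)` outside `v` with the ideal equation `(c′)·𝔟 = (b′)·𝔟₀`, and `β₀, β ∉ v` with `c′·β = b′·β₀`: then
`g₀⁻¹g ∈ Gal(K̄/K(𝔪))` and `κ_𝔪(g₀⁻¹g)·β_v = β₀,v` (the Artin lifts `σ_{b′}`, `σ_{c′}` have `κ = b′_v⁻¹`, `c′_v⁻¹`, and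
`g₀⁻¹g·σ_{c′}·σ_{b′}⁻¹` fixes every layer). [cite: deShalit1987, II.1.7 (p. 41), II.4.12 (p. 66–68)] [cite: NeukirchANT1999, Ch. VI §7 Thm. (7.1)] -/
theorem rayAdicCharacter_inv_mul_mul_integerUnit_eq_of_ideal_eq {𝔟₀ 𝔟 : Ideal (𝓞 K)} (h𝔟₀0 : 𝔟₀ ≠ ⊥) (h𝔟0 : 𝔟 ≠ ⊥)
    {g₀ g : absoluteGaloisGroup K}
    (hg₀ : ∀ n : ℕ, absRestrictNormalHom (rayClassField K (𝔪 * v.asIdeal ^ n)) g₀ =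
      artinSymbol (galFrob K (rayClassField K (𝔪 * v.asIdeal ^ n))) 𝔟₀)
    (hg : ∀ n : ℕ, absRestrictNormalHom (rayClassField K (𝔪 * v.asIdeal ^ n)) g =
      artinSymbol (galFrob K (rayClassField K (𝔪 * v.asIdeal ^ n))) 𝔟)
    (heq : absRestrictNormalHom (rayClassField K 𝔪) g₀ = absRestrictNormalHom (rayClassField K 𝔪) g)
    {b' c' : 𝓞 K} (hb'1 : b' - 1 ∈ 𝔪) (hc'1 : c' - 1 ∈ 𝔪) (hb'v : b' ∉ v.asIdeal) (hc'v : c' ∉ v.asIdeal)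
    (hideal : Ideal.span {c'} * 𝔟 = Ideal.span {b'} * 𝔟₀)
    {β₀ β : 𝓞 K} (hβ₀v : β₀ ∉ v.asIdeal) (hβv : β ∉ v.asIdeal) (hβ : c' * β = b' * β₀) :
    ∃ hmem : g₀⁻¹ * g ∈ (absRestrictNormalHom (rayClassField K 𝔪)).ker,
      rayAdicCharacter h𝔪 hv hw ⟨g₀⁻¹ * g, hmem⟩ * integerUnit v β hβv = integerUnit v β₀ hβ₀v := by
  have hmem : g₀⁻¹ * g ∈ (absRestrictNormalHom (rayClassField K 𝔪)).ker := by
    rw [MonoidHom.mem_ker, map_mul, map_inv, heq, inv_mul_cancel]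
  have hb'0 : b' ≠ 0 := by rintro rfl; exact hb'v v.asIdeal.zero_mem
  have hc'0 : c' ≠ 0 := by rintro rfl; exact hc'v v.asIdeal.zero_mem
  -- Artin lifts of `(b')`, `(c')` and their `κ`
  obtain ⟨σb, hσb⟩ := exists_forall_absRestrictNormalHom_eq_artinHom_span_singleton h𝔪 hv hb'0 hb'1 hb'v
  obtain ⟨σc, hσc⟩ := exists_forall_absRestrictNormalHom_eq_artinHom_span_singleton h𝔪 hv hc'0 hc'1 hc'v
  have hσbmem := mem_ker_of_forall_absRestrictNormalHom_eq_artinHom h𝔪 hv hb'0 hb'1 hb'v hσb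
  have hσcmem := mem_ker_of_forall_absRestrictNormalHom_eq_artinHom h𝔪 hv hc'0 hc'1 hc'v hσc
  have hκb := rayAdicCharacter_eq_integerUnit_inv h𝔪 hv hw hb'0 hb'1 hb'v hσb
  have hκc := rayAdicCharacter_eq_integerUnit_inv h𝔪 hv hw hc'0 hc'1 hc'v hσc
  -- `ρ := (g₀⁻¹g)·σ_{c'}·σ_{b'}⁻¹` fixes every layer `K(𝔪vⁿ)`
  have hb'0' : Ideal.span {b'} ≠ ⊥ := by simpa [Ideal.span_singleton_eq_bot] using hb'0
  have hc'0' : Ideal.span {c'} ≠ ⊥ := by simpa [Ideal.span_singleton_eq_bot] using hc'0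
  have hρ : ∀ n : ℕ, g₀⁻¹ * g * σc * σb⁻¹ ∈ (absRestrictNormalHom (rayClassField K (𝔪 * v.asIdeal ^ n))).ker := by
    intro n
    have hA : artinSymbol (galFrob K (rayClassField K (𝔪 * v.asIdeal ^ n))) (Ideal.span {c'}) *
        artinSymbol (galFrob K (rayClassField K (𝔪 * v.asIdeal ^ n))) 𝔟 =
        artinSymbol (galFrob K (rayClassField K (𝔪 * v.asIdeal ^ n))) (Ideal.span {b'}) *
        artinSymbol (galFrob K (rayClassField K (𝔪 * v.asIdeal ^ n))) 𝔟₀ := by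
      rw [← artinSymbol_mul _ hc'0' h𝔟0, ← artinSymbol_mul _ hb'0' h𝔟₀0, hideal]
    rw [MonoidHom.mem_ker, map_mul, map_inv, mul_inv_eq_one, map_mul, map_mul, map_inv, hg₀ n, hg n, hσb n, hσc n,
      artinHom_toPrincipalIdeal_coe _ hb'0, artinHom_toPrincipalIdeal_coe _ hc'0]
    -- goal: `A𝔟₀⁻¹ * A𝔟 * A(c') = A(b')` in the abelian group `Gal(K(𝔪vⁿ)/K)`
    rw [mul_assoc, inv_mul_eq_iff_eq_mul,
      mul_comm (artinSymbol _ 𝔟) (artinSymbol _ (Ideal.span {c'})), hA]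
    exact mul_comm _ _
  set G₁ : ↥(absRestrictNormalHom (rayClassField K 𝔪)).ker := ⟨g₀⁻¹ * g, hmem⟩ with hG₁
  set Sb : ↥(absRestrictNormalHom (rayClassField K 𝔪)).ker := ⟨σb, hσbmem⟩ with hSb
  set Sc : ↥(absRestrictNormalHom (rayClassField K 𝔪)).ker := ⟨σc, hσcmem⟩ with hSc
  have hκρ : rayAdicCharacter h𝔪 hv hw (G₁ * Sc * Sb⁻¹) = 1 :=
    rayAdicCharacter_eq_one_of_forall_mem_ker h𝔪 hv hw _ hρ
  have e1 : G₁ * Sc = (G₁ * Sc * Sb⁻¹) * Sb := by group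
  have e2 : rayAdicCharacter h𝔪 hv hw G₁ * rayAdicCharacter h𝔪 hv hw Sc = rayAdicCharacter h𝔪 hv hw Sb := by
    rw [← map_mul, e1, map_mul, hκρ, one_mul]
  -- `e2 : b'_v · κ G₁ = c'_v`
  rw [hκb, hκc, mul_inv_eq_iff_eq_mul, eq_inv_mul_iff_mul_eq] at e2
  refine ⟨hmem, ?_⟩
  -- `b'_v · (κ G₁ · β_v) = c'_v · β_v = (c'β)_v = (b'β₀)_v = b'_v · β₀,v`
  have e3 : integerUnit v b' hb'v * (rayAdicCharacter h𝔪 hv hw G₁ * integerUnit v β hβv) =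
      integerUnit v b' hb'v * integerUnit v β₀ hβ₀v := by
    rw [← mul_assoc, e2, ← integerUnit_mul v hc'v hβv (mul_not_mem' hc'v hβv),
      ← integerUnit_mul v hb'v hβ₀v (mul_not_mem' hb'v hβ₀v)]
    exact Units.ext (Subtype.ext (by rw [coe_integerUnit, coe_integerUnit, hβ]))
  exact mul_left_cancel e3

end Key

/-! ### §3. The constant `U_τ` pinned by `ψ` -/

section Constant

variable [IsTotallyComplex K] {v : HeightOneSpectrum (𝓞 K)}

/-- ★★★ **(U♯), general reference moduli.**  `κ`-reference modulus `𝔑 ≠ 0` (`v ∤ 𝔑`, `w_𝔑 = 1`) and Artin reference modulus `𝔐₀ ≠ 0` with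
`𝔐₀ ⊆ 𝔣ψ`, `𝔐₀ ⊆ 𝔑`, `𝔐₀ ⊆ v`; `ψ` with de Shalit's II.1.5 (ii)(iii)(iv) as hypotheses.  There is `U ∈ 𝒪_vˣ` with
`κ_𝔪(τ·g)·ψ(𝔟)_v = U` for every `κ`-modulus `𝔪 ⊆ 𝔑`, every Artin modulus `𝔐 ≠ 0`, `𝔐 ⊆ 𝔐₀`, `𝔐 ⊆ 𝔪`, every ideal `𝔟` prime to `𝔐` with
`(𝔟, K(𝔐)/K) = τ⁻¹|_{K(𝔐)}` and every Artin lift `g` of `𝔟` on the `v`-tower over `K(𝔪)` — EXACTLY, no residual unit.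
[cite: deShalit1987, II.1.5 (15)–(18) (p. 35–36), II.4.12 (p. 66–68), II.4.14 (38)–(40) (p. 71–72)] [cite: NeukirchANT1999, Ch. VI §7 Thm. (7.1)] -/
theorem exists_unit_forall_rayAdicCharacter_mul_integerUnit_grossen_eq_of_moduli {𝔑 𝔐₀ : Ideal (𝓞 K)}
    (h𝔑0 : 𝔑 ≠ ⊥) (hv𝔑 : ¬ 𝔑 ≤ v.asIdeal) (hw𝔑 : ∀ u : (𝓞 K)ˣ, (u : 𝓞 K) - 1 ∈ 𝔑 → u = 1)
    (h𝔐₀0 : 𝔐₀ ≠ ⊥) {𝔣ψ : Ideal (𝓞 K)} (h𝔐₀𝔣 : 𝔐₀ ≤ 𝔣ψ) (h𝔐₀𝔑 : 𝔐₀ ≤ 𝔑) (h𝔐₀v : 𝔐₀ ≤ v.asIdeal)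
    (τ : absoluteGaloisGroup K) (ψ : Ideal (𝓞 K) → 𝓞 K)
    (hψmul : ∀ 𝔞 𝔟 : Ideal (𝓞 K), IsCoprime 𝔞 𝔣ψ → IsCoprime 𝔟 𝔣ψ → ψ (𝔞 * 𝔟) = ψ 𝔞 * ψ 𝔟)
    (hψspan : ∀ 𝔞 : Ideal (𝓞 K), IsCoprime 𝔞 𝔣ψ → Ideal.span {ψ 𝔞} = 𝔞)
    (hψone : ∀ α : 𝓞 K, α - 1 ∈ 𝔣ψ → ψ (Ideal.span {α}) = α) :
    ∃ U : (v.adicCompletionIntegers K)ˣ, ∀ (𝔪 : Ideal (𝓞 K)) (h𝔪 : 𝔪 ≠ ⊥) (hv𝔪 : ¬ 𝔪 ≤ v.asIdeal)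
      (hw𝔪 : ∀ u : (𝓞 K)ˣ, (u : 𝓞 K) - 1 ∈ 𝔪 → u = 1) (_ : 𝔪 ≤ 𝔑) (𝔐 : Ideal (𝓞 K)) (_ : 𝔐 ≠ ⊥)
      (_ : 𝔐 ≤ 𝔐₀) (_ : 𝔐 ≤ 𝔪) (𝔟 : Ideal (𝓞 K)) (_ : IsCoprime 𝔟 𝔐) (g : absoluteGaloisGroup K)
      (_ : ∀ n : ℕ, absRestrictNormalHom (rayClassField K (𝔪 * v.asIdeal ^ (n + 1))) g =
        artinSymbol (galFrob K (rayClassField K (𝔪 * v.asIdeal ^ (n + 1)))) 𝔟)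
      (_ : absRestrictNormalHom (rayClassField K 𝔐) τ⁻¹ = artinSymbol (galFrob K (rayClassField K 𝔐)) 𝔟),
      ∃ (hβv : ψ 𝔟 ∉ v.asIdeal) (hτg : τ * g ∈ (absRestrictNormalHom (rayClassField K 𝔪)).ker),
        rayAdicCharacter h𝔪 hv𝔪 hw𝔪 ⟨τ * g, hτg⟩ * integerUnit v (ψ 𝔟) hβv = U := by
  -- the reference ideal `𝔟₀` with `(𝔟₀, K(𝔐₀)/K) = τ⁻¹|` and its universal Artin lift `g₀`
  obtain ⟨𝔟₀, h𝔟₀0, h𝔟₀c, h𝔟₀τ⟩ := exists_ideal_artinSymbol_eq_absRestrictNormalHom h𝔐₀0 τ⁻¹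
  have h𝔟₀c𝔣 : IsCoprime 𝔟₀ 𝔣ψ := isCoprime_of_le' h𝔟₀c h𝔐₀𝔣
  have h𝔟₀c𝔑 : IsCoprime 𝔟₀ 𝔑 := isCoprime_of_le' h𝔟₀c h𝔐₀𝔑
  have h𝔟₀cv : IsCoprime 𝔟₀ v.asIdeal := isCoprime_of_le' h𝔟₀c h𝔐₀v
  have hψ𝔟₀v : ψ 𝔟₀ ∉ v.asIdeal := not_mem_of_span_eq_of_isCoprime (hψspan 𝔟₀ h𝔟₀c𝔣) h𝔟₀cv
  obtain ⟨g₀, hg₀⟩ := exists_forall_absRestrictNormalHom_eq_artinHom (K := K)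
    (Units.mk0 (𝔟₀ : FractionalIdeal (𝓞 K)⁰ K) (coeIdeal_ne_zero_of_ne_bot h𝔟₀0))
  have hg₀' : ∀ n : ℕ, absRestrictNormalHom (rayClassField K (𝔑 * v.asIdeal ^ n)) g₀ =
      artinSymbol (galFrob K (rayClassField K (𝔑 * v.asIdeal ^ n))) 𝔟₀ := fun n => by
    rw [hg₀ _ (mul_ne_zero h𝔑0 (pow_ne_zero _ v.ne_bot))
      (unitsMk0_coeIdeal_mem_idealsPrimeTo (mul_ne_zero h𝔑0 (pow_ne_zero _ v.ne_bot)) h𝔟₀0 (h𝔟₀c𝔑.mul_right h𝔟₀cv.pow_right)),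
      artinHom_unitsMk0_coeIdeal _ h𝔟₀0]
  have hτ₀ : absRestrictNormalHom (rayClassField K 𝔑) τ⁻¹ = artinSymbol (galFrob K (rayClassField K 𝔑)) 𝔟₀ :=
    absRestrictNormalHom_eq_artinSymbol_ideal_of_le h𝔐₀0 h𝔑0 h𝔐₀𝔑 h𝔟₀0 h𝔟₀c h𝔟₀τ.symm
  have hτg₀ : τ * g₀ ∈ (absRestrictNormalHom (rayClassField K 𝔑)).ker := by
    have h0 := hg₀' 0
    rw [pow_zero, mul_one] at h0
    rw [MonoidHom.mem_ker, map_mul, h0, ← hτ₀, map_inv, mul_inv_cancel]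
  refine ⟨rayAdicCharacter h𝔑0 hv𝔑 hw𝔑 ⟨τ * g₀, hτg₀⟩ * integerUnit v (ψ 𝔟₀) hψ𝔟₀v, ?_⟩
  intro 𝔪 h𝔪 hv𝔪 hw𝔪 hle 𝔐 h𝔐0 h𝔐le h𝔐𝔪 𝔟 h𝔟c g hg hτ
  -- coprimalities of `𝔟`
  have h𝔟c₀ : IsCoprime 𝔟 𝔐₀ := isCoprime_of_le' h𝔟c h𝔐le
  have h𝔟c𝔣 : IsCoprime 𝔟 𝔣ψ := isCoprime_of_le' h𝔟c₀ h𝔐₀𝔣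
  have h𝔟cv : IsCoprime 𝔟 v.asIdeal := isCoprime_of_le' h𝔟c₀ h𝔐₀v
  have h𝔟c𝔪 : IsCoprime 𝔟 𝔪 := isCoprime_of_le' h𝔟c h𝔐𝔪
  have h𝔟0 : 𝔟 ≠ ⊥ := by
    rintro rfl
    rw [Ideal.isCoprime_iff_sup_eq, bot_sup_eq] at h𝔟cv
    exact v.isPrime.ne_top h𝔟cv
  have hψ𝔟v : ψ 𝔟 ∉ v.asIdeal := not_mem_of_span_eq_of_isCoprime (hψspan 𝔟 h𝔟c𝔣) h𝔟cv
  -- `g` and `τ⁻¹` read on the reference towers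
  have hg' : ∀ n : ℕ, absRestrictNormalHom (rayClassField K (𝔑 * v.asIdeal ^ n)) g =
      artinSymbol (galFrob K (rayClassField K (𝔑 * v.asIdeal ^ n))) 𝔟 := fun n =>
    absRestrictNormalHom_eq_artinSymbol_ideal_of_le (mul_ne_zero h𝔪 (pow_ne_zero _ v.ne_bot))
      (mul_ne_zero h𝔑0 (pow_ne_zero _ v.ne_bot)) (Ideal.mul_mono hle (Ideal.pow_le_pow_right (Nat.le_succ n))) h𝔟0
      (h𝔟c𝔪.mul_right h𝔟cv.pow_right) (hg n)
  have hτ₀' : absRestrictNormalHom (rayClassField K 𝔐₀) τ⁻¹ = artinSymbol (galFrob K (rayClassField K 𝔐₀)) 𝔟 :=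
    absRestrictNormalHom_eq_artinSymbol_ideal_of_le h𝔐0 h𝔐₀0 h𝔐le h𝔟0 h𝔟c hτ
  have hτ' : absRestrictNormalHom (rayClassField K 𝔑) τ⁻¹ = artinSymbol (galFrob K (rayClassField K 𝔑)) 𝔟 :=
    absRestrictNormalHom_eq_artinSymbol_ideal_of_le h𝔐₀0 h𝔑0 h𝔐₀𝔑 h𝔟0 h𝔟c₀ hτ₀'
  have heq : absRestrictNormalHom (rayClassField K 𝔑) g₀ = absRestrictNormalHom (rayClassField K 𝔑) g := by
    have a := hg₀' 0
    have b := hg' 0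
    rw [pow_zero, mul_one] at a b
    rw [a, b, ← hτ₀, hτ']
  -- ray equivalence `(c)𝔟 = (b)𝔟₀ mod 𝔐₀` from the equal Artin symbols on `K(𝔐₀)`, normalised to `b′ ≡ c′ ≡ 1`
  have hA : artinSymbol (galFrob K (rayClassField K 𝔐₀)) 𝔟₀ = artinSymbol (galFrob K (rayClassField K 𝔐₀)) 𝔟 := by
    rw [h𝔟₀τ, hτ₀']
  rw [artinSymbol_eq_artinSymbol_iff_rayClassRel h𝔐₀0 h𝔟₀0 h𝔟₀c h𝔟0 h𝔟c₀] at hA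
  obtain ⟨b, c, -, -, hccop, hbc, -, hbc𝔟⟩ := hA
  obtain ⟨x, hx, y, hy, hxy⟩ := Ideal.isCoprime_iff_exists.mp hccop
  obtain ⟨d, rfl⟩ := Ideal.mem_span_singleton'.mp hx
  have hc'1 : d * c - 1 ∈ 𝔐₀ := by
    rw [show d * c - 1 = -y by linear_combination hxy]; exact 𝔐₀.neg_mem hy
  have hb'1 : d * b - 1 ∈ 𝔐₀ := by
    rw [show d * b - 1 = d * (b - c) + (d * c - 1) by ring]
    exact 𝔐₀.add_mem (𝔐₀.mul_mem_left _ hbc) hc'1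
  have hideal : Ideal.span {d * c} * 𝔟 = Ideal.span {d * b} * 𝔟₀ := by
    rw [← Ideal.span_singleton_mul_span_singleton, ← Ideal.span_singleton_mul_span_singleton, mul_assoc, mul_assoc, hbc𝔟]
  -- `ψ` on the ideal equation: `(dc)·ψ𝔟 = (db)·ψ𝔟₀` exactly
  have hβ : d * c * ψ 𝔟 = d * b * ψ 𝔟₀ := by
    have h1 : ψ (Ideal.span {d * c} * 𝔟) = d * c * ψ 𝔟 := by
      rw [hψmul _ _ (isCoprime_span_singleton_of_sub_one_mem (h𝔐₀𝔣 hc'1)) h𝔟c𝔣, hψone _ (h𝔐₀𝔣 hc'1)]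
    have h2 : ψ (Ideal.span {d * b} * 𝔟₀) = d * b * ψ 𝔟₀ := by
      rw [hψmul _ _ (isCoprime_span_singleton_of_sub_one_mem (h𝔐₀𝔣 hb'1)) h𝔟₀c𝔣, hψone _ (h𝔐₀𝔣 hb'1)]
    rw [← h1, ← h2, hideal]
  -- the `κ`-calculus on the `𝔑`-tower
  obtain ⟨hmem, hkey⟩ := rayAdicCharacter_inv_mul_mul_integerUnit_eq_of_ideal_eq h𝔑0 hv𝔑 hw𝔑 h𝔟₀0 h𝔟0 hg₀' hg' heq
    (h𝔐₀𝔑 hb'1) (h𝔐₀𝔑 hc'1) (not_mem_of_sub_one_mem_of_le hb'1 h𝔐₀v) (not_mem_of_sub_one_mem_of_le hc'1 h𝔐₀v)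
    hideal hψ𝔟₀v hψ𝔟v hβ
  -- `τg ∈ Gal(K̄/K(𝔪))`
  have hgres : absRestrictNormalHom (rayClassField K 𝔪) g = artinSymbol (galFrob K (rayClassField K 𝔪)) 𝔟 :=
    absRestrictNormalHom_eq_artinSymbol_ideal_of_le (mul_ne_zero h𝔪 (pow_ne_zero _ v.ne_bot)) h𝔪 Ideal.mul_le_right h𝔟0
      (h𝔟c𝔪.mul_right h𝔟cv.pow_right) (hg 0)
  have hτ𝔪 : absRestrictNormalHom (rayClassField K 𝔪) τ⁻¹ = artinSymbol (galFrob K (rayClassField K 𝔪)) 𝔟 :=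
    absRestrictNormalHom_eq_artinSymbol_ideal_of_le h𝔐0 h𝔪 h𝔐𝔪 h𝔟0 h𝔟c hτ
  have hτg : τ * g ∈ (absRestrictNormalHom (rayClassField K 𝔪)).ker := by
    rw [MonoidHom.mem_ker, map_mul, hgres, ← hτ𝔪, map_inv, mul_inv_cancel]
  refine ⟨hψ𝔟v, hτg, ?_⟩
  rw [← rayAdicCharacter_eq_of_le h𝔑0 hv𝔑 hw𝔑 h𝔪 hle hv𝔪 hw𝔪 ⟨τ * g, hτg⟩,
    show (⟨τ * g, ker_absRestrictNormalHom_rayClassField_anti h𝔪 hle hτg⟩ : ↥(absRestrictNormalHom (rayClassField K 𝔑)).ker) =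
        ⟨τ * g₀, hτg₀⟩ * ⟨g₀⁻¹ * g, hmem⟩ from Subtype.ext (by simp only [Subgroup.coe_mul]; group),
    map_mul, mul_assoc, hkey]

/-- ★★★ **(U♯) — `κ_𝔪(τ·g_𝔟)·ψ(𝔟)_v = U_τ` EXACTLY at the frame of the `j = 0` seam**: `K` totally complex, `v ≠ v̄` finite primes with
`w_{v̄²} = 1`, `τ ∈ Γ_K`, `ψ : Ideal (𝓞 K) → 𝓞 K` with conductor ideal `𝔣ψ ≠ 0` satisfying de Shalit's II.1.5 (ii) (multiplicative on ideals
prime to `𝔣ψ`), (iii) (`(ψ 𝔞) = 𝔞`), (iv) (`ψ((α)) = α` for `α ≡ 1 (mod 𝔣ψ)`) — HYPOTHESES (the fifth print supplies them).  There is `U ∈ 𝒪_vˣ`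
such that for EVERY `κ`-modulus `𝔪 ⊆ v̄²` (`𝔪 ≠ 0`, `v ∤ 𝔪`, `w_𝔪 = 1`), every Artin modulus `𝔐 ≠ 0` with `𝔐 ⊆ 𝔣ψ·v̄²·v`, `𝔐 ⊆ 𝔪`, every
ideal `𝔟` prime to `𝔐` with `(𝔟, K(𝔐)/K) = τ⁻¹|_{K(𝔐)}`, and every `g ∈ Γ_K` restricting to `(𝔟, K(𝔪v^{n+1})/K)` on the whole tower:
`τ·g ∈ Gal(K̄/K(𝔪))` and **`κ_𝔪(τ·g)·ψ(𝔟)_v = U`** (no residual global unit: two instances are ray-equivalent mod `𝔣ψ·v̄²·v`,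
`(c′)𝔟 = (b′)𝔟₀`, `b′ ≡ c′ ≡ 1`, so `c′ψ(𝔟) = b′ψ(𝔟₀)` by (ii)+(iv) while `κ_{v̄²}(g₀⁻¹g) = c′_v/b′_v`) — the hypothesis (U♯) of the
bridge `P1_of_lane` of cell `bsd-print-cf2`.
[cite: deShalit1987, II.1.5 (15)–(18) (p. 35–36), II.4.12 (p. 66–68), II.4.14 (38)–(40) (p. 71–72)] [cite: NeukirchANT1999, Ch. VI §7 Thm. (7.1)] -/
theorem exists_unit_forall_rayAdicCharacter_mul_integerUnit_grossen_eq {vbar : HeightOneSpectrum (𝓞 K)} (hne : vbar ≠ v)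
    (hw2 : ∀ u : (𝓞 K)ˣ, (u : 𝓞 K) - 1 ∈ vbar.asIdeal ^ 2 → u = 1) (τ : absoluteGaloisGroup K)
    {𝔣ψ : Ideal (𝓞 K)} (h𝔣ψ : 𝔣ψ ≠ ⊥) (ψ : Ideal (𝓞 K) → 𝓞 K)
    (hψmul : ∀ 𝔞 𝔟 : Ideal (𝓞 K), IsCoprime 𝔞 𝔣ψ → IsCoprime 𝔟 𝔣ψ → ψ (𝔞 * 𝔟) = ψ 𝔞 * ψ 𝔟)
    (hψspan : ∀ 𝔞 : Ideal (𝓞 K), IsCoprime 𝔞 𝔣ψ → Ideal.span {ψ 𝔞} = 𝔞)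
    (hψone : ∀ α : 𝓞 K, α - 1 ∈ 𝔣ψ → ψ (Ideal.span {α}) = α) :
    ∃ U : (v.adicCompletionIntegers K)ˣ, ∀ (𝔪 : Ideal (𝓞 K)) (h𝔪 : 𝔪 ≠ ⊥) (hv𝔪 : ¬ 𝔪 ≤ v.asIdeal)
      (hw𝔪 : ∀ u : (𝓞 K)ˣ, (u : 𝓞 K) - 1 ∈ 𝔪 → u = 1) (_ : 𝔪 ≤ vbar.asIdeal ^ 2) (𝔐 : Ideal (𝓞 K)) (_ : 𝔐 ≠ ⊥)
      (_ : 𝔐 ≤ 𝔣ψ * vbar.asIdeal ^ 2 * v.asIdeal) (_ : 𝔐 ≤ 𝔪) (𝔟 : Ideal (𝓞 K)) (_ : IsCoprime 𝔟 𝔐) (g : absoluteGaloisGroup K)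
      (_ : ∀ n : ℕ, absRestrictNormalHom (rayClassField K (𝔪 * v.asIdeal ^ (n + 1))) g =
        artinSymbol (galFrob K (rayClassField K (𝔪 * v.asIdeal ^ (n + 1)))) 𝔟)
      (_ : absRestrictNormalHom (rayClassField K 𝔐) τ⁻¹ = artinSymbol (galFrob K (rayClassField K 𝔐)) 𝔟),
      ∃ (hβv : ψ 𝔟 ∉ v.asIdeal) (hτg : τ * g ∈ (absRestrictNormalHom (rayClassField K 𝔪)).ker),
        rayAdicCharacter h𝔪 hv𝔪 hw𝔪 ⟨τ * g, hτg⟩ * integerUnit v (ψ 𝔟) hβv = U := by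
  have h𝔑0 : vbar.asIdeal ^ 2 ≠ ⊥ := pow_ne_zero 2 vbar.ne_bot
  have hv𝔑 : ¬ vbar.asIdeal ^ 2 ≤ v.asIdeal := fun h =>
    hne (HeightOneSpectrum.ext (vbar.isMaximal.eq_of_le v.isPrime.ne_top
      ((Ideal.IsPrime.pow_le_iff (I := vbar.asIdeal) two_ne_zero).mp h)))
  exact exists_unit_forall_rayAdicCharacter_mul_integerUnit_grossen_eq_of_moduli h𝔑0 hv𝔑 hw2
    (mul_ne_zero (mul_ne_zero h𝔣ψ h𝔑0) v.ne_bot) ((Ideal.mul_le_right).trans Ideal.mul_le_right)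
    ((Ideal.mul_le_right).trans Ideal.mul_le_left) Ideal.mul_le_left τ ψ hψmul hψspan hψone

end Constant

end Literature.NumberTheory.NumberFields

end
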